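import Summits.AtomisticToContinuum.Crystallization.Theses.ChartedPlanarOrder
import Summits.AtomisticToContinuum.Crystallization.Theses.NashClassCertificates
import Summits.AtomisticToContinuum.Crystallization.Theorems.HullMinimalityLayeredWindowsFrequently
import Summits.AtomisticToContinuum.Crystallization.Theorems.ChartedPlanarOrderLayeredHullPoint
import Summits.AtomisticToContinuum.Crystallization.Theorems.ChartedPlanarOrderCleanBallKFactorisation

/-!
# The Nash near field decides the clean-ball case of charted planar order

decomp-a2c · lens-3 · g7 — the `nnf-door` line of crux `ChartedPlanarOrder.CleanBallPlanarOrder` (stmt-32136),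
assembled from its two landed stubs:

* `LayeredWindowsLocal.layeredWindows_seq_of_goodWindows_freq` (= `stub_nnfDoor`): under
  `NashClassCertificates.NashNearField` (stmt-16827), clean balls frequently ⟹ one scale `a ∈ [47/50, 1]` and
  `a`-scale layered Barlow windows two-way matched with translates of `x N`, frequently in `N`, at every radius
  and tolerance;
* `ChartedPlanarOrderLayeredHullPoint.stub_layeredHullPoint`: such windows ⟹ a `39a/50`-separated, `2a`-dense hull
  point with two exact in-plane periods of length `a`.

Hence the EDGE `NashNearField → CleanBallPlanarOrder` (with `δ = 39a/50`, `r = 2a`, `b = a`; exact periods are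
`δ/4`-almost periods at every centre).  Combined with `ChartedPlanarOrderKFactorisation.cleanBallCase_of_CB_and_rungs`
this places lens-2's `MatrixSaturationDichotomy.CleanBallCase` below `NashNearField ∧ PlanarCoherence ∧ PlanarLockIn ∧
ThirdPeriodFromSecond`, per sequence.  0 sorry. [folklore]
-/

namespace Summit.AtomisticToContinuum.Crystallization.Theorems.ChartedPlanarOrderCleanBallOfNashNearField

/-- **Edge** `NashNearField → CleanBallPlanarOrder` (stmt-16827 ⟹ stmt-32136). [folklore] -/
theorem cleanBallPlanarOrder_of_nashNearField :
    Summit.AtomisticToContinuum.Crystallization.Theses.NashClassCertificates.NashNearField →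
    Summit.AtomisticToContinuum.Crystallization.Theses.ChartedPlanarOrder.CleanBallPlanarOrder := by
  intro hNF x hx _hchart hclean _hdhp
  obtain ⟨a, ha₁, ha₂, hW⟩ :=
    Summit.AtomisticToContinuum.Crystallization.Theorems.LayeredWindowsLocal.layeredWindows_seq_of_goodWindows_freq
      hNF x hx hclean
  obtain ⟨X, t₁, t₂, hsep, hdense, hhull, ht₁, ht₂, hind, hper⟩ :=
    Summit.AtomisticToContinuum.Crystallization.Theorems.ChartedPlanarOrderLayeredHullPoint.stub_layeredHullPoint
      x a ha₁ ha₂ hW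
  refine ⟨X, 39 / 50 * a, 2 * a, a, by linarith, hsep, hdense, hhull, fun c => ⟨t₁, t₂, by linarith, by linarith,
    by linarith, hind, fun p hp _ => ?_⟩⟩
  obtain ⟨h1, h2, h3, h4⟩ := hper p hp
  have hq : ∀ q : EuclideanSpace ℝ (Fin 3), q ∈ X → ∃ q' ∈ X, dist q q' ≤ 39 / 50 * a / 4 :=
    fun q hq => ⟨q, hq, by rw [dist_self]; linarith⟩
  exact ⟨hq _ h1, hq _ h2, hq _ h3, hq _ h4⟩

/-- **K below the Nash near field and the lens-3 rungs, per sequence**: `NashNearField ∧ PlanarCoherence ∧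
PlanarLockIn ∧ ThirdPeriodFromSecond ⟹ MatrixSaturationDichotomy.CleanBallCase` (stmt-26136), by the edge above and
`ChartedPlanarOrderKFactorisation.cleanBallCase_of_CB_and_rungs`. [folklore] -/
theorem cleanBallCase_of_nashNearField_and_rungs :
    Summit.AtomisticToContinuum.Crystallization.Theses.NashClassCertificates.NashNearField →
    Summit.AtomisticToContinuum.Crystallization.Theses.ChartedPlanarOrder.PlanarCoherence →
    Summit.AtomisticToContinuum.Crystallization.Theses.ChartedPlanarOrder.PlanarLockIn →
    Summit.AtomisticToContinuum.Crystallization.Theses.ChartedPlanarOrder.ThirdPeriodFromSecond →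
    Summit.AtomisticToContinuum.Crystallization.Theses.MatrixSaturationDichotomy.CleanBallCase :=
  fun hNF =>
    Summit.AtomisticToContinuum.Crystallization.Theorems.ChartedPlanarOrderKFactorisation.cleanBallCase_of_CB_and_rungs
      (cleanBallPlanarOrder_of_nashNearField hNF)

end Summit.AtomisticToContinuum.Crystallization.Theorems.ChartedPlanarOrderCleanBallOfNashNearField
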